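/-
Width seat `ym-line-cbag-p1-w3` (prover-ym-line-cbag-p1-w3-g2-0), route `ColdBoxAllGroups`, crux `BulkAllGroups`
(stmt-QuantumFields-22255), line `dlr-chessboard-G` (lead `ym-line-cbag-p2`, skeleton `Cruxes/BulkAllGroups/Lines/birth.lean` v4):
the ENERGY OF THE LINEARISED DATUM for every compact gauge group — G-port of `…BulkDominatesColdBoxWLinearisedDatumEnergy`.
-/
import Summits.QuantumFields.YangMills.Theorems.ColdBoxAllGroupsBoxFloorAllGroupsCubicG
import Summits.QuantumFields.YangMills.Theorems.WeakCouplingRatesBulkDominatesColdBoxWLinearisedDatumEnergy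
import Summits.QuantumFields.YangMills.Theorems.EquipartitionCriticalityFreeEnergyLogCoefficientExpChartMeasure
import Literature.MathematicalPhysics.QuantumFieldTheory.Balaban1983to89.MatrixNorms

/-!
# Crux `BulkAllGroups` (stmt-QuantumFields-22255), interfaces `KernelMeanExpansionG` / `KernelCovExpansionG`: the energy of the
# LINEARISED datum in the exponential chart of a compact group presented in `U(N)` — exponential coordinates of a small configuration and
# the bound `Σ_c M_{a_c}(a_c) ≤ 2·Σ_p cost_p(W) + #P·380 m³`

G-port of `Theorems/WeakCouplingRatesBulkDominatesColdBoxWLinearisedDatumEnergy.lean` (the `SU(2)` line `dlr-chessboard`, gnomonic chart,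
three colours, `cost ≈ Σ_c s_c²`, cubic constant `362`).  For a continuous unitary representation `ρ : G →* U(N)` with exponential chart
`ψ = expChart ρ : ℝ^D → G`, `D = dimE ρ` (`Theorems/EquipartitionCriticality…Defs`, `ρ(ψ a) = e^{lieIso ρ a}`, `lieIso ρ` a linear isometry onto
skew-Hermitian matrices), the Wilson cost of a plaquette whose four links are chart points `ψ(a_e)`, `‖a_e‖ ≤ m ≤ 1/4`, is
`½‖a₁ + a₂ − a₃ − a₄‖² ± 190 m³` (the BOX line's brick «CubicG» `abs_cost_expChart_holonomy_sub_half_norm_sq_le`), and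
`‖a₁ + a₂ − a₃ − a₄‖² = Σ_{c<D} s_c(p)²` with `s_c` the linear circulation `sCirc` of the colour component `e ↦ (a_e)_c`.  Hence:

* §1 `frob_sub_one_le_sqrt_mul_opDist1` — `‖ρ g − 1‖_F ≤ √N·‖ρ g − 1‖_op` for unitary `ρ g` (`N − Re tr = ½‖·‖_F²`, Balaban's
  `2[1 − Re tr/N] ≤ ‖· − 1‖²_op`); **`exists_expChartRadius_opDist1`** — there is `r₁ = r₁(ρ) > 0` such that every `g` with
  `‖ρ g − 1‖_op ≤ r₁` is a chart point `ψ(a)` with `‖a‖ ≤ 2√N·‖ρ g − 1‖_op` (von Neumann's local surjectivity `exists_chartRadius`, in the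
  operator-norm currency `opDist1 ∘ ρ` of the BULK line's gauge bricks `exists_gauge_opDist1_le_of_crudeGoodG` / `opDist1_le_uniform_of_exterior_leG`);
* §2 `norm_sq_eq_sum_sq`, `sum_sCirc_sq_eq_norm_sq` — `‖v‖² = Σ_c v_c²` on `ℝ^D` and `Σ_c s_c(p)² = ‖a₁ + a₂ − a₃ − a₄‖²`;
  **`abs_plaqCostAt_sub_half_sum_sq_le_of_eq_expChart`** — for a configuration agreeing with chart points on the four edges of a plaquette,
  `|cost_p(W) − ½Σ_c s_c(p)²| ≤ 190 m³`;
* §3 **`sum_formM_chartCoords_le`** — for `W` agreeing with chart points `ψ(a_e)`, `‖a_e‖ ≤ m ≤ 1/4`, on the edges of the enlarged box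
  `E = boxEdgesAt dirCorner (2H+3)`, the `D` one-colour Maxwell forms of the coordinate components (datum = free values = `a_c`) satisfy
  `Σ_c M_{a_c}(a_c) ≤ 2·Σ_p cost_{dirCorner+p}(W) + #P·380 m³` over the plaquette labels `P` of the enlarged box (the G-free self-gluing identity
  `formM_self_glue` of the `SU(2)` file is reused by import).

With `W` the forest-gauged truncated gauge copy of a crude-good datum (`cost ≤ β^{2δ−1}` on the enlarged box, `m ≲ √N·H³β^{δ−1/2}`) this is
`≤ 6(2H+3)⁴(2β^{2δ−1} + 380 m³) = O((2H+3)⁴β^{2δ−1})` eventually — the energy clause of `KernelMeanExpansionG` / `KernelCovExpansionG`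
(`Theorems/ColdBoxAllGroupsDefs.lean`, constant `CE` existential).  No new definition; standard axioms.  NOT a claim about the mass gap; the
Yang–Mills mass gap is NOT proved by any of this (rung-level support, RECORD label).
-/

set_option autoImplicit false

noncomputable section

open Finset
open scoped Matrix.Norms.Frobenius
open Literature.Probability.LatticeModels
open Literature.MathematicalPhysics.QuantumLattice
open Literature.MathematicalPhysics.QuantumFieldTheory
open Literature.MathematicalPhysics.QuantumFieldTheory.LatticeMaxwell
open Literature.MathematicalPhysics.QuantumFieldTheory.AxialGauge
open Literature.MathematicalPhysics.QuantumFieldTheory.Balaban1983to89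
open Summit.QuantumFields.YangMills.Theorems.WeakCouplingRates
open Summit.QuantumFields.YangMills.Theorems.FreeEnergyLogCoefficient

namespace Summit.QuantumFields.YangMills.Theorems.ColdBoxAllGroups

variable {N : ℕ} {G : Type*} [Group G] (ρ : G →* Matrix (Fin N) (Fin N) ℂ)

/-! ## §1 Exponential coordinates of a small element, operator-norm currency -/

/-- `‖U − 1‖_F ≤ √N·‖U − 1‖_op` for a unitary `U ∈ U(N)`, `N ≥ 1` (`N − Re tr U = ½‖U − 1‖_F²` and `2(1 − Re tr U/N) ≤ ‖U − 1‖²_op`). -/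
theorem frob_sub_one_le_sqrt_mul_opDist1 [NeZero N] {U : Matrix (Fin N) (Fin N) ℂ} (hU : U ∈ Matrix.unitaryGroup (Fin N) ℂ) :
    ‖U - 1‖ ≤ Real.sqrt N * UnitaryModel.opDist1 U := by
  have hN : (0 : ℝ) < N := by exact_mod_cast Nat.pos_of_ne_zero (NeZero.ne N)
  have h1 : (N : ℝ) - U.trace.re = ‖U - 1‖ ^ 2 / 2 := sub_re_trace_eq_half_norm_sub_one_sq hU
  have h2 := MatrixNorms.two_mul_one_sub_nReTr_le_opDist1_sq (n := Fin N) hU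
  simp only [UnitaryModel.nReTr, Fintype.card_fin] at h2
  have h3 : 2 * (1 - U.trace.re / (N : ℝ)) = 2 * ((N : ℝ) - U.trace.re) / N := by
    field_simp
  rw [h3, h1] at h2
  have h4 : ‖U - 1‖ ^ 2 ≤ (Real.sqrt N * UnitaryModel.opDist1 U) ^ 2 := by
    rw [mul_pow, Real.sq_sqrt hN.le]
    rw [div_le_iff₀ hN] at h2
    linarith
  exact (pow_le_pow_iff_left₀ (norm_nonneg _) (mul_nonneg (Real.sqrt_nonneg _) (UnitaryModel.opDist1_nonneg _)) two_ne_zero).1 h4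

variable [TopologicalSpace G] [CompactSpace G]

/-- **Exponential coordinates of a small element, operator-norm currency.**  For a faithful continuous unitary `ρ : G →* U(N)`, `N ≥ 1`,
there is `r₁ = r₁(ρ) > 0` such that every `g` with `‖ρ g − 1‖_op ≤ r₁` is a chart point `expChart ρ a = g` with
`‖a‖ ≤ 2√N·‖ρ g − 1‖_op` (von Neumann's local surjectivity `exists_chartRadius`: `‖a‖ ≤ 2‖ρ g − 1‖_F ≤ 2√N‖ρ g − 1‖_op`). -/
theorem exists_expChartRadius_opDist1 [NeZero N] (hρ : Continuous ρ) (hinj : Function.Injective ρ)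
    (hρu : ∀ g, ρ g ∈ Matrix.unitaryGroup (Fin N) ℂ) :
    ∃ r₁ : ℝ, 0 < r₁ ∧ ∀ g : G, UnitaryModel.opDist1 (ρ g) ≤ r₁ →
      ∃ a : EuclideanSpace ℝ (Fin (dimE ρ)), expChart ρ a = g ∧ ‖a‖ ≤ 2 * Real.sqrt N * UnitaryModel.opDist1 (ρ g) := by
  obtain ⟨r₀, hr₀, -, hsurj⟩ := exists_chartRadius ρ hρ hinj hρu
  have hN1 : (1 : ℝ) ≤ Real.sqrt N := by
    rw [Real.le_sqrt' one_pos, one_pow]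
    exact_mod_cast Nat.pos_of_ne_zero (NeZero.ne N)
  have hNpos : 0 < Real.sqrt N := by linarith
  refine ⟨r₀ / Real.sqrt N, div_pos hr₀ hNpos, fun g hg => ?_⟩
  have hF : ‖ρ g - 1‖ ≤ Real.sqrt N * UnitaryModel.opDist1 (ρ g) := frob_sub_one_le_sqrt_mul_opDist1 (hρu g)
  have hF' : ‖ρ g - 1‖ ≤ 2 * r₀ := by
    have : Real.sqrt N * UnitaryModel.opDist1 (ρ g) ≤ Real.sqrt N * (r₀ / Real.sqrt N) := mul_le_mul_of_nonneg_left hg hNpos.le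
    rw [mul_div_cancel₀ _ hNpos.ne'] at this
    linarith
  obtain ⟨a, ha, han⟩ := hsurj g hF'
  exact ⟨a, ha, han.trans (by nlinarith)⟩

/-! ## §2 The plaquette cost of four chart points: `½Σ_c s_c(p)² ± 190 m³` -/

omit [TopologicalSpace G] [CompactSpace G] in
/-- `‖v‖² = Σ_c v_c²` on `ℝ^D`. -/
theorem norm_sq_eq_sum_sq {D : ℕ} (v : EuclideanSpace ℝ (Fin D)) : ‖v‖ ^ 2 = ∑ c, v c ^ 2 := by
  rw [EuclideanSpace.norm_eq, Real.sq_sqrt (Finset.sum_nonneg fun c _ => by positivity)]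
  exact Finset.sum_congr rfl fun c _ => by rw [Real.norm_eq_abs, sq_abs]

omit [TopologicalSpace G] [CompactSpace G] in
/-- The colour circulations of edge coordinates ARE the components of the linear circulation of the coordinates:
`Σ_c (sCirc (e ↦ (a e)_c) (x;i,j))² = ‖a(x,i) + a(x+eᵢ,j) − a(x+eⱼ,i) − a(x,j)‖²`. -/
theorem sum_sCirc_sq_eq_norm_sq {D : ℕ} (a : Literature.MathematicalPhysics.QuantumLattice.ZdEdge 4 → EuclideanSpace ℝ (Fin D))
    (x : Site 4) (i j : Fin 4) :
    ∑ c, sCirc (fun e => a e c) (x, i, j) ^ 2 =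
      ‖a (x, i) + a (x + Pi.single i 1, j) - a (x + Pi.single j 1, i) - a (x, j)‖ ^ 2 := by
  rw [norm_sq_eq_sum_sq]
  refine Finset.sum_congr rfl fun c _ => ?_
  simp only [sCirc, PiLp.sub_apply, PiLp.add_apply]

/-- **The plaquette cost of a configuration agreeing with chart points on the four edges of a plaquette** (continuous unitary-valued `ρ`,
coordinates `‖a_e‖ ≤ m ≤ 1/4`): `|cost_{(x;i,j)}(W) − ½Σ_c s_c(x;i,j)²| ≤ 190 m³`, `s_c = sCirc (e ↦ (a e)_c)`. -/
theorem abs_plaqCostAt_sub_half_sum_sq_le_of_eq_expChart (hρ : Continuous ρ) (W : LGConfig 4 G)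
    (a : Literature.MathematicalPhysics.QuantumLattice.ZdEdge 4 → EuclideanSpace ℝ (Fin (dimE ρ))) (x : Site 4) (i j : Fin 4)
    {m : ℝ} (hm : m ≤ 1 / 4)
    (h1 : W (x, i) = expChart ρ (a (x, i))) (h2 : W (x + Pi.single i 1, j) = expChart ρ (a (x + Pi.single i 1, j)))
    (h3 : W (x + Pi.single j 1, i) = expChart ρ (a (x + Pi.single j 1, i))) (h4 : W (x, j) = expChart ρ (a (x, j)))
    (n1 : ‖a (x, i)‖ ≤ m) (n2 : ‖a (x + Pi.single i 1, j)‖ ≤ m) (n3 : ‖a (x + Pi.single j 1, i)‖ ≤ m) (n4 : ‖a (x, j)‖ ≤ m) :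
    |plaqCostAt ρ x i j W - (1 / 2 : ℝ) * ∑ c, sCirc (fun e => a e c) (x, i, j) ^ 2| ≤ 190 * m ^ 3 := by
  have h := abs_cost_expChart_holonomy_sub_half_norm_sq_le ρ hρ (a (x, i)) (a (x + Pi.single i 1, j)) (a (x + Pi.single j 1, i))
    (a (x, j)) hm n1 n2 n3 n4
  have hc : plaqCostAt ρ x i j W =
      (N : ℝ) - (ρ (expChart ρ (a (x, i)) * expChart ρ (a (x + Pi.single i 1, j)) * (expChart ρ (a (x + Pi.single j 1, i)))⁻¹ *
        (expChart ρ (a (x, j)))⁻¹)).trace.re := by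
    simp only [plaqCostAt, plaquetteObs, plaquetteHolonomyZd, h1, h2, h3, h4]
  rw [hc, sum_sCirc_sq_eq_norm_sq, show (1 / 2 : ℝ) * ‖a (x, i) + a (x + Pi.single i 1, j) - a (x + Pi.single j 1, i) - a (x, j)‖ ^ 2 =
    ‖a (x, i) + a (x + Pi.single i 1, j) - a (x + Pi.single j 1, i) - a (x, j)‖ ^ 2 / 2 by ring]
  exact h

/-! ## §3 The energy of the linearised configuration -/

variable {H : ℕ}

/-- **Energy of the linearised datum, every compact group presented in `U(N)`.**  Let `W : ℤ⁴ → G` agree, on every edge of the enlarged box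
`E = boxEdgesAt dirCorner (2H+3)`, with the chart point `expChart ρ (a_e)` of coordinates `‖a_e‖ ≤ m`, `m ≤ 1/4` (`ρ` continuous unitary-valued).
Then the `D = dimE ρ` one-colour Maxwell forms of the coordinate components (datum = free values = `(a_·)_c`) satisfy
`Σ_c M_{a_c}(a_c) ≤ 2·Σ_p cost_{dirCorner+p}(W) + #P·380 m³` over the plaquette labels `P` of the enlarged box. -/
theorem sum_formM_chartCoords_le (hρ : Continuous ρ) (W : LGConfig 4 G)
    (a : Literature.MathematicalPhysics.QuantumLattice.ZdEdge 4 → EuclideanSpace ℝ (Fin (dimE ρ))) {m : ℝ} (hm : m ≤ 1 / 4)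
    (hW : ∀ e ∈ boxEdgesAt dirCorner (2 * H + 3), W e = expChart ρ (a e))
    (ha : ∀ e ∈ boxEdgesAt dirCorner (2 * H + 3), ‖a e‖ ≤ m) :
    ∑ c : Fin (dimE ρ), formM (fun e => e ∉ dirFreeEdges H) dirCorner (2 * H + 3) (fun e => a e c)
        (fun e' : DirFree H => a e'.1.1 c) ≤
      2 * (∑ p ∈ plaquettesIn (halfOpenBox 4 (2 * H + 3)),
          plaqCostAt ρ (Plaq.shift dirCorner p).1 (Plaq.shift dirCorner p).2.1 (Plaq.shift dirCorner p).2.2 W) +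
        (plaquettesIn (halfOpenBox 4 (2 * H + 3))).card * (380 * m ^ 3) := by
  have hform : ∀ c : Fin (dimE ρ), formM (fun e => e ∉ dirFreeEdges H) dirCorner (2 * H + 3) (fun e => a e c)
      (fun e' : DirFree H => a e'.1.1 c) =
        ∑ p ∈ plaquettesIn (halfOpenBox 4 (2 * H + 3)), sCirc (fun e => a e c) (Plaq.shift dirCorner p) ^ 2 :=
    fun c => formM_self_glue (pin := fun e => e ∉ dirFreeEdges H) (a := dirCorner) (n := 2 * H + 3) (fun e => a e c)
  simp_rw [hform]
  have hconst : ((plaquettesIn (halfOpenBox 4 (2 * H + 3))).card : ℝ) * (380 * m ^ 3) =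
      ∑ _p ∈ plaquettesIn (halfOpenBox 4 (2 * H + 3)), 380 * m ^ 3 := by
    rw [Finset.sum_const, nsmul_eq_mul]
  rw [Finset.sum_comm, hconst, Finset.mul_sum, ← Finset.sum_add_distrib]
  refine Finset.sum_le_sum fun p hp => ?_
  obtain ⟨e1, e2, e3, e4⟩ := shift_edges_mem_boxEdgesAt (a := dirCorner) hp
  have h := abs_plaqCostAt_sub_half_sum_sq_le_of_eq_expChart ρ hρ W a (Plaq.shift dirCorner p).1 (Plaq.shift dirCorner p).2.1
    (Plaq.shift dirCorner p).2.2 hm (hW _ e1) (hW _ e2) (hW _ e3) (hW _ e4) (ha _ e1) (ha _ e2) (ha _ e3) (ha _ e4)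
  have h' := (abs_le.1 h).1
  have hp' : ((Plaq.shift dirCorner p).1, (Plaq.shift dirCorner p).2.1, (Plaq.shift dirCorner p).2.2) = Plaq.shift dirCorner p := rfl
  rw [hp'] at h'
  linarith

end Summit.QuantumFields.YangMills.Theorems.ColdBoxAllGroups

end
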